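import Mathlib.RingTheory.PowerBasis
import Mathlib.RingTheory.AdjoinRoot
import Mathlib.LinearAlgebra.Dual.Basis
import Mathlib.LinearAlgebra.Determinant
import Mathlib.LinearAlgebra.Matrix.Block
import HarnessLib

/-!
# The dualizing ("tail") form of a monogenic algebra: `Hom_B(A, B)` is free of rank one over `A = B[x]`

Topic `RingTheory/CompleteIntersection` (the one-variable case of Tate's local duality for finite free
complete intersections, de Smit–Rubin–Schoof 1997, Prop. 2.1 / Tate's appendix to Mazur–Roberts 1970).

Let `B` be ANY commutative ring and `A` a commutative `B`-algebra with a power basis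
`pb = (1, x, …, x^{n-1})` (Mathlib `PowerBasis B A`; e.g. `A = B[X]/(f)` for a MONIC `f` of degree `n`,
`AdjoinRoot.powerBasis' hf`). The **tail form** `λ : A →ₗ[B] B` is the last coordinate functional: `λ(y)` =
the coefficient of `x^{n-1}` when `y` is written in the power basis. The `B`-bilinear form `(y, z) ↦ λ(yz)`
is symmetric, `A`-balanced (`(ay, z) = (y, az)`), and **perfect over any base ring**: its Gram matrix in the
power basis, `λ(x^{i+j})`, vanishes for `i + j < n - 1` and is `1` for `i + j = n - 1`, so after reversing
one index it is unitriangular, of determinant `1`. Consequently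

* `tailPairing_bijective` / `tailPairingEquiv`: `A ≃ₗ[B] Module.Dual B A`, `y ↦ λ(y · )` — every `B`-linear
  functional on `A` is `λ(y · )` for a unique `y` (`existsUnique_dual_eq_tailForm_mul`), i.e. `Hom_B(A, B)`
  is free of rank one over `A`, generated by `λ` (a Frobenius / symmetric algebra structure on `A/B`);
* `tailDualBasis`: the basis `(x₀^*, …, x_{n-1}^*)` of `A` dual to the power basis under the form,
  `λ(xᵢ^* · x^j) = δ_{ij}` (`tailForm_tailDualBasis_mul_pow`), with the two expansion formulas
  `y = ∑ᵢ λ(xᵢ^* y) x^i` (`sum_tailForm_tailDualBasis_mul_smul_pow`) and `y = ∑ᵢ λ(y x^i) xᵢ^*`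
  (`sum_tailForm_mul_pow_smul_tailDualBasis`);
* transport along `B`-algebra isomorphisms (`tailForm_map`) and the unfolding on `B[X]/(f)`
  (`tailForm_powerBasis'_mk`: `λ(g mod f)` = coefficient of `X^{deg f - 1}` in `g %ₘ f`).

Contrast with the trace form (Mathlib `Algebra.traceForm`, perfect only in the étale case, dual basis
`x^i / f'(x)` by Euler's lemma): the tail form needs no separability — it is the right duality for the
totally ramified quotients `ℤ_p⟦T⟧/(T^m + p)` and their finite quotients `Λ/(T^m + p, p^k)` (cell
`pub/bsd-print-x9`: self-duality `T_𝔮^* ≅ T_{𝔮}(ψ⁻¹)(1)` of Howard's specialised modules, Howard 2004 H.4 /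
Lemma 2.1.1 at `𝔮 = (T^m + p)`; Pontryagin self-duality of the finite coefficient rings `A_{m,k}`).

Everything is proved; definitions with bodies: `tailForm`, `tailPairing`, `tailPairingEquiv`, `tailDualBasis`.
No named fact, no instance, no notation. Degenerate case: for `pb.dim = 0` (`A = 0`) the tail form is `0`
by definition and all statements hold trivially.

References: [DeSmitRubinSchoof1997] B. de Smit, K. Rubin, R. Schoof, *Criteria for complete intersections*
(in: Modular Forms and Fermat's Last Theorem, 1997), Prop. 2.1 (Tate) and Cor. 2.2, case `n = 1`; the
one-variable statement is classical (Euler–Tate; e.g. Serre, *Local Fields*, III §6 for the étale analogue).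
-/

noncomputable section

open Polynomial Module Matrix

namespace Literature.RingTheory.CompleteIntersection

universe u v

variable {B : Type u} [CommRing B] {A : Type v} [CommRing A] [Algebra B A]

/-! ## §1 The tail form -/

/-- **The tail form** of a power basis `pb = (1, x, …, x^{n-1})` of the `B`-algebra `A`: the `B`-linear
functional `λ : A → B` picking the LAST coordinate, `λ(y) =` the coefficient of `x^{n-1}` in the expansion of
`y` (`pb.basis.coord (n - 1)`); by convention `0` when `n = 0` (then `A = 0`). For `A = B[X]/(f)`, `f` monic
of degree `n`, `λ(g mod f)` is the coefficient of `X^{n-1}` in `g %ₘ f` (`tailForm_powerBasis'_mk`). It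
generates `Hom_B(A, B)` as a free `A`-module of rank one (`tailPairingEquiv`).
[cite: DeSmitRubinSchoof1997, Prop. 2.1 (case n = 1)] -/
def tailForm (pb : PowerBasis B A) : A →ₗ[B] B :=
  if h : 0 < pb.dim then pb.basis.coord ⟨pb.dim - 1, Nat.sub_one_lt_of_lt h⟩ else 0

/-- Unfolding: for `0 < n`, `λ = pb.basis.coord (n-1)`. [cite: DeSmitRubinSchoof1997, Prop. 2.1 (case n = 1)] -/
theorem tailForm_eq_coord (pb : PowerBasis B A) (h : 0 < pb.dim) :
    tailForm pb = pb.basis.coord ⟨pb.dim - 1, Nat.sub_one_lt_of_lt h⟩ := by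
  rw [tailForm, dif_pos h]

/-- `λ(y)` is the `(n-1)`-st coordinate of `y` in the power basis (`0 < n`).
[cite: DeSmitRubinSchoof1997, Prop. 2.1 (case n = 1)] -/
theorem tailForm_apply (pb : PowerBasis B A) (h : 0 < pb.dim) (y : A) :
    tailForm pb y = pb.basis.repr y ⟨pb.dim - 1, Nat.sub_one_lt_of_lt h⟩ := by
  rw [tailForm_eq_coord pb h, Basis.coord_apply]

/-- Degenerate case: if `n = 0` the tail form is `0` (convention of this file). [cite: DeSmitRubinSchoof1997, Prop. 2.1 (case n = 1)] -/
theorem tailForm_of_dim_eq_zero (pb : PowerBasis B A) (h : pb.dim = 0) : tailForm pb = 0 := by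
  rw [tailForm, dif_neg (by omega)]

/-- **Values on the power basis**: for `k < n`, `λ(x^k) = 1` if `k = n - 1` and `0` otherwise.
[cite: DeSmitRubinSchoof1997, Prop. 2.1 (case n = 1)] -/
theorem tailForm_gen_pow (pb : PowerBasis B A) {k : ℕ} (hk : k < pb.dim) :
    tailForm pb (pb.gen ^ k) = if k = pb.dim - 1 then 1 else 0 := by
  classical
  have h : 0 < pb.dim := lt_of_le_of_lt (Nat.zero_le k) hk
  have hb : pb.gen ^ k = pb.basis ⟨k, hk⟩ := (pb.basis_eq_pow ⟨k, hk⟩).symm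
  rw [tailForm_apply pb h, hb, pb.basis.repr_self, Finsupp.single_apply]
  simp only [Fin.mk.injEq]

/-- `λ(x^{n-1}) = 1` (`0 < n`). [cite: DeSmitRubinSchoof1997, Prop. 2.1 (case n = 1)] -/
theorem tailForm_gen_pow_dim_sub_one (pb : PowerBasis B A) (h : 0 < pb.dim) :
    tailForm pb (pb.gen ^ (pb.dim - 1)) = 1 := by
  rw [tailForm_gen_pow pb (Nat.sub_one_lt_of_lt h), if_pos rfl]

/-- `λ(x^k) = 0` for `k < n - 1`. [cite: DeSmitRubinSchoof1997, Prop. 2.1 (case n = 1)] -/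
theorem tailForm_gen_pow_of_lt (pb : PowerBasis B A) {k : ℕ} (hk : k < pb.dim - 1) :
    tailForm pb (pb.gen ^ k) = 0 := by
  rw [tailForm_gen_pow pb (by omega), if_neg (by omega)]

/-- **Transport**: the tail form of the transported power basis `pb.map e` along a `B`-algebra isomorphism
`e : A ≃ₐ[B] A'` is `λ ∘ e⁻¹`. [cite: DeSmitRubinSchoof1997, Prop. 2.1 (case n = 1)] -/
theorem tailForm_map {A' : Type*} [CommRing A'] [Algebra B A'] (pb : PowerBasis B A) (e : A ≃ₐ[B] A')
    (y : A') : tailForm (pb.map e) y = tailForm pb (e.symm y) := by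
  by_cases h : 0 < pb.dim
  · have h' : 0 < (pb.map e).dim := h
    rw [tailForm_apply _ h', tailForm_apply _ h]
    simp only [PowerBasis.map_basis, Basis.map_repr, PowerBasis.map_dim]
    rfl
  · have h0 : pb.dim = 0 := by omega
    rw [tailForm_of_dim_eq_zero pb h0, tailForm_of_dim_eq_zero (pb.map e) h0, LinearMap.zero_apply,
      LinearMap.zero_apply]

/-- **Unfolding on `B[X]/(f)`** (`f` monic): `λ(g mod f)` is the coefficient of `X^{deg f - 1}` in the
remainder `g %ₘ f`. [cite: DeSmitRubinSchoof1997, Prop. 2.1 (case n = 1)] -/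
theorem tailForm_powerBasis'_mk {f : B[X]} (hf : f.Monic) (h : 0 < f.natDegree) (g : B[X]) :
    tailForm (AdjoinRoot.powerBasis' hf) (AdjoinRoot.mk f g) = (g %ₘ f).coeff (f.natDegree - 1) := by
  have h' : 0 < (AdjoinRoot.powerBasis' hf).dim := h
  rw [tailForm_apply _ h']
  change (AdjoinRoot.powerBasisAux' hf).repr (AdjoinRoot.mk f g) ⟨f.natDegree - 1, _⟩ = _
  rw [AdjoinRoot.powerBasisAux'_repr_apply_to_fun, AdjoinRoot.modByMonicHom_mk]

/-! ## §2 The pairing `(y, z) ↦ λ(yz)` and its perfectness -/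

/-- **The tail pairing** `y ↦ (z ↦ λ(yz))`, a `B`-linear map `A → Hom_B(A, B)`.
[cite: DeSmitRubinSchoof1997, Prop. 2.1 (case n = 1)] -/
def tailPairing (pb : PowerBasis B A) : A →ₗ[B] Module.Dual B A :=
  (LinearMap.mul B A).compr₂ (tailForm pb)

/-- Unfolding: `tailPairing pb y z = λ(y z)`. [cite: DeSmitRubinSchoof1997, Prop. 2.1 (case n = 1)] -/
@[simp]
theorem tailPairing_apply_apply (pb : PowerBasis B A) (y z : A) : tailPairing pb y z = tailForm pb (y * z) :=
  rfl

/-- The pairing is symmetric. [cite: DeSmitRubinSchoof1997, Prop. 2.1 (case n = 1)] -/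
theorem tailPairing_comm (pb : PowerBasis B A) (y z : A) : tailPairing pb y z = tailPairing pb z y := by
  rw [tailPairing_apply_apply, tailPairing_apply_apply, mul_comm]

/-- The pairing is `A`-balanced: `(a y, z) = (y, a z)` — i.e. `y ↦ λ(y · )` is `A`-linear for the action
`(a φ)(z) = φ(a z)` of `A` on `Hom_B(A, B)`. [cite: DeSmitRubinSchoof1997, Prop. 2.1 (case n = 1)] -/
theorem tailPairing_mul_left (pb : PowerBasis B A) (a y z : A) :
    tailPairing pb (a * y) z = tailPairing pb y (a * z) := by
  rw [tailPairing_apply_apply, tailPairing_apply_apply, mul_comm a y, mul_assoc]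

/-- The dual basis of the power basis, re-indexed by `i ↦ n - 1 - i` (auxiliary: in this basis of
`Hom_B(A, B)` the matrix of the tail pairing is unitriangular). [cite: DeSmitRubinSchoof1997, Prop. 2.1 (case n = 1)] -/
def revDualBasis (pb : PowerBasis B A) : Basis (Fin pb.dim) B (Module.Dual B A) :=
  pb.basis.dualBasis.reindex Fin.revPerm

/-- **Gram matrix**: the `(i, j)` entry of the matrix of the tail pairing (power basis → reversed dual basis)
is `λ(x^{j + (n - 1 - i)})`. [cite: DeSmitRubinSchoof1997, Prop. 2.1 (case n = 1)] -/
theorem toMatrix_tailPairing_apply (pb : PowerBasis B A) (i j : Fin pb.dim) :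
    LinearMap.toMatrix pb.basis (revDualBasis pb) (tailPairing pb) i j =
      tailForm pb (pb.gen ^ ((j : ℕ) + (pb.dim - 1 - i))) := by
  classical
  rw [LinearMap.toMatrix_apply, revDualBasis, Basis.repr_reindex_apply, Fin.revPerm_symm, Fin.revPerm_apply,
    Basis.dualBasis_repr, tailPairing_apply_apply, pb.basis_eq_pow, pb.basis_eq_pow, ← pow_add, Fin.val_rev]
  congr 2
  omega

/-- Below the diagonal the Gram matrix vanishes: `λ(x^{j + n - 1 - i}) = 0` for `j < i`.
[cite: DeSmitRubinSchoof1997, Prop. 2.1 (case n = 1)] -/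
theorem toMatrix_tailPairing_of_lt (pb : PowerBasis B A) {i j : Fin pb.dim} (hji : j < i) :
    LinearMap.toMatrix pb.basis (revDualBasis pb) (tailPairing pb) i j = 0 := by
  rw [toMatrix_tailPairing_apply]
  exact tailForm_gen_pow_of_lt pb (by have := i.2; have := j.2; omega)

/-- On the diagonal the Gram matrix is `1`: `λ(x^{n-1}) = 1`. [cite: DeSmitRubinSchoof1997, Prop. 2.1 (case n = 1)] -/
theorem toMatrix_tailPairing_diag (pb : PowerBasis B A) (i : Fin pb.dim) :
    LinearMap.toMatrix pb.basis (revDualBasis pb) (tailPairing pb) i i = 1 := by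
  rw [toMatrix_tailPairing_apply]
  have h : (i : ℕ) + (pb.dim - 1 - i) = pb.dim - 1 := by have := i.2; omega
  rw [h]
  exact tailForm_gen_pow_dim_sub_one pb (lt_of_le_of_lt (Nat.zero_le _) i.2)

/-- The Gram matrix (power basis → reversed dual basis) is upper unitriangular, hence has determinant `1`.
[cite: DeSmitRubinSchoof1997, Prop. 2.1 (case n = 1)] -/
theorem det_toMatrix_tailPairing (pb : PowerBasis B A) :
    (LinearMap.toMatrix pb.basis (revDualBasis pb) (tailPairing pb)).det = 1 := by
  have hT : (LinearMap.toMatrix pb.basis (revDualBasis pb) (tailPairing pb)).BlockTriangular id :=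
    fun i j hji => toMatrix_tailPairing_of_lt pb hji
  rw [Matrix.det_of_upperTriangular hT, Finset.prod_eq_one]
  intro i _
  exact toMatrix_tailPairing_diag pb i

/-- **Perfectness of the tail pairing over any base ring**: `y ↦ λ(y · )` is a bijection
`A → Hom_B(A, B)`. [cite: DeSmitRubinSchoof1997, Prop. 2.1 (case n = 1)] -/
theorem tailPairing_bijective (pb : PowerBasis B A) : Function.Bijective (tailPairing pb) := by
  by_cases h : 0 < pb.dim
  · have hu : IsUnit (LinearMap.toMatrix pb.basis (revDualBasis pb) (tailPairing pb)).det := by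
      rw [det_toMatrix_tailPairing]; exact isUnit_one
    have he : ⇑(LinearEquiv.ofIsUnitDet hu) = ⇑(tailPairing pb) := rfl
    rw [← he]
    exact (LinearEquiv.ofIsUnitDet hu).bijective
  · have h0 : pb.dim = 0 := by omega
    haveI : IsEmpty (Fin pb.dim) := by rw [h0]; exact Fin.isEmpty
    haveI : Subsingleton A := pb.basis.repr.toEquiv.subsingleton
    refine ⟨Function.injective_of_subsingleton _, fun φ => ⟨0, ?_⟩⟩
    exact Subsingleton.elim _ _

/-- **`A ≃ₗ[B] Hom_B(A, B)`, `y ↦ λ(y · )`** — the tail form generates the `B`-dual of `A` as a free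
`A`-module of rank one (Frobenius structure of a monogenic algebra).
[cite: DeSmitRubinSchoof1997, Prop. 2.1 (case n = 1)] -/
def tailPairingEquiv (pb : PowerBasis B A) : A ≃ₗ[B] Module.Dual B A :=
  LinearEquiv.ofBijective (tailPairing pb) (tailPairing_bijective pb)

/-- Unfolding: `tailPairingEquiv pb y = λ(y · )`. [cite: DeSmitRubinSchoof1997, Prop. 2.1 (case n = 1)] -/
@[simp]
theorem tailPairingEquiv_apply (pb : PowerBasis B A) (y : A) : tailPairingEquiv pb y = tailPairing pb y := rfl

/-- **Every `B`-linear functional on `A` is `λ(y · )` for a unique `y ∈ A`.**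
[cite: DeSmitRubinSchoof1997, Prop. 2.1 (case n = 1)] -/
theorem existsUnique_dual_eq_tailForm_mul (pb : PowerBasis B A) (φ : Module.Dual B A) :
    ∃! y : A, ∀ z, φ z = tailForm pb (y * z) := by
  obtain ⟨y, hy⟩ := (tailPairing_bijective pb).2 φ
  refine ⟨y, fun z => by rw [← hy, tailPairing_apply_apply], fun y' hy' => ?_⟩
  refine (tailPairing_bijective pb).1 (hy.symm ▸ ?_)
  ext z
  rw [tailPairing_apply_apply, ← hy' z]

/-- Non-degeneracy on the left: `λ(y z) = 0` for all `z` forces `y = 0`. [cite: DeSmitRubinSchoof1997, Prop. 2.1 (case n = 1)] -/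
theorem eq_zero_of_forall_tailForm_mul_eq_zero (pb : PowerBasis B A) {y : A}
    (hy : ∀ z, tailForm pb (y * z) = 0) : y = 0 := by
  refine (tailPairing_bijective pb).1 ?_
  ext z
  rw [tailPairing_apply_apply, hy, map_zero, LinearMap.zero_apply]

/-! ## §3 The dual basis under the tail form and the expansion formulas -/

/-- **The basis of `A` dual to the power basis under the tail form**: `xᵢ^* := (λ-pairing)⁻¹(i-th
coordinate functional)`, so that `λ(xᵢ^* z)` is the `i`-th coordinate of `z`.
[cite: DeSmitRubinSchoof1997, Cor. 2.2 (case n = 1)] -/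
def tailDualBasis (pb : PowerBasis B A) : Basis (Fin pb.dim) B A :=
  pb.basis.dualBasis.map (tailPairingEquiv pb).symm

/-- Defining property: `λ(xᵢ^* z) = (i-th power-basis coordinate of z)`. [cite: DeSmitRubinSchoof1997, Cor. 2.2 (case n = 1)] -/
theorem tailForm_tailDualBasis_mul (pb : PowerBasis B A) (i : Fin pb.dim) (z : A) :
    tailForm pb (tailDualBasis pb i * z) = pb.basis.repr z i := by
  classical
  have h : tailPairing pb (tailDualBasis pb i) = pb.basis.dualBasis i := by
    rw [tailDualBasis, Basis.map_apply, ← tailPairingEquiv_apply, LinearEquiv.apply_symm_apply]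
  rw [← tailPairing_apply_apply, h, Basis.dualBasis_apply]

/-- **`λ(xᵢ^* x^j) = δ_{ij}`**. [cite: DeSmitRubinSchoof1997, Cor. 2.2 (case n = 1)] -/
theorem tailForm_tailDualBasis_mul_pow (pb : PowerBasis B A) (i j : Fin pb.dim) :
    tailForm pb (tailDualBasis pb i * pb.gen ^ (j : ℕ)) = if j = i then 1 else 0 := by
  classical
  rw [tailForm_tailDualBasis_mul, ← pb.basis_eq_pow, pb.basis.repr_self, Finsupp.single_apply]

/-- The coordinates of `y` in the dual basis are `λ(y x^i)`. [cite: DeSmitRubinSchoof1997, Cor. 2.2 (case n = 1)] -/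
theorem tailDualBasis_repr_apply (pb : PowerBasis B A) (y : A) (i : Fin pb.dim) :
    (tailDualBasis pb).repr y i = tailForm pb (y * pb.gen ^ (i : ℕ)) := by
  classical
  rw [tailDualBasis, Basis.map_repr, LinearEquiv.trans_apply, LinearEquiv.symm_symm, tailPairingEquiv_apply,
    Basis.dualBasis_repr, tailPairing_apply_apply, pb.basis_eq_pow]

/-- **Expansion in the power basis**: `y = ∑ᵢ λ(xᵢ^* y) • x^i`. [cite: DeSmitRubinSchoof1997, Cor. 2.2 (case n = 1)] -/
theorem sum_tailForm_tailDualBasis_mul_smul_pow (pb : PowerBasis B A) (y : A) :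
    ∑ i : Fin pb.dim, tailForm pb (tailDualBasis pb i * y) • pb.gen ^ (i : ℕ) = y := by
  conv_rhs => rw [← pb.basis.sum_repr y]
  refine Finset.sum_congr rfl fun i _ => ?_
  rw [tailForm_tailDualBasis_mul, pb.basis_eq_pow]

/-- **Expansion in the dual basis**: `y = ∑ᵢ λ(y x^i) • xᵢ^*`. [cite: DeSmitRubinSchoof1997, Cor. 2.2 (case n = 1)] -/
theorem sum_tailForm_mul_pow_smul_tailDualBasis (pb : PowerBasis B A) (y : A) :
    ∑ i : Fin pb.dim, tailForm pb (y * pb.gen ^ (i : ℕ)) • tailDualBasis pb i = y := by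
  conv_rhs => rw [← (tailDualBasis pb).sum_repr y]
  refine Finset.sum_congr rfl fun i _ => ?_
  rw [tailDualBasis_repr_apply]

/-- `λ(z) = ∑ᵢ λ(xᵢ^* z) λ(x^i)`-type bookkeeping in its most useful form: two elements with the same
pairings against the power basis are equal. [cite: DeSmitRubinSchoof1997, Prop. 2.1 (case n = 1)] -/
theorem ext_of_tailForm_mul_pow (pb : PowerBasis B A) {y y' : A}
    (h : ∀ i : Fin pb.dim, tailForm pb (y * pb.gen ^ (i : ℕ)) = tailForm pb (y' * pb.gen ^ (i : ℕ))) : y = y' := by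
  rw [← sum_tailForm_mul_pow_smul_tailDualBasis pb y, ← sum_tailForm_mul_pow_smul_tailDualBasis pb y']
  exact Finset.sum_congr rfl fun i _ => by rw [h i]

/-! ## §4 Frobenius reciprocity: `Hom_A(N, A) ≅ Hom_B(N, B)` for every `A`-module `N` -/

section Reciprocity

variable (pb : PowerBasis B A) {N : Type*} [AddCommGroup N] [Module A N] [Module B N] [IsScalarTower B A N]

/-- Post-composition with the tail form: `Hom_A(N, A) → Hom_B(N, B)`, `φ ↦ λ ∘ φ` (a `B`-linear map).
[cite: DeSmitRubinSchoof1997, Prop. 2.1 (case n = 1)] -/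
def tailFormComp : (N →ₗ[A] A) →ₗ[B] (N →ₗ[B] B) where
  toFun φ := (tailForm pb).comp (φ.restrictScalars B)
  map_add' φ φ' := by ext n; simp
  map_smul' b φ := by ext n; simp

/-- Unfolding: `tailFormComp pb φ n = λ(φ n)`. [cite: DeSmitRubinSchoof1997, Prop. 2.1 (case n = 1)] -/
@[simp]
theorem tailFormComp_apply (φ : N →ₗ[A] A) (n : N) : tailFormComp pb φ n = tailForm pb (φ n) := rfl

/-- `φ ↦ λ ∘ φ` is injective: an `A`-linear map to `A` is determined by its tail-form shadow (the kernel of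
`λ` contains no non-zero ideal of `A`). [cite: DeSmitRubinSchoof1997, Prop. 2.1 (case n = 1)] -/
theorem tailFormComp_injective : Function.Injective (tailFormComp pb (N := N)) := by
  intro φ φ' h
  ext n
  rw [← sub_eq_zero]
  refine eq_zero_of_forall_tailForm_mul_eq_zero pb fun z => ?_
  have h1 : tailForm pb (φ (z • n)) = tailForm pb (φ' (z • n)) := by
    rw [← tailFormComp_apply, ← tailFormComp_apply, h]
  rw [sub_mul, map_sub, sub_eq_zero, mul_comm, mul_comm (φ' n), ← smul_eq_mul, ← smul_eq_mul, ← map_smul,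
    ← map_smul]
  exact h1

/-- The `B`-linear functional `a ↦ ψ(a • n)` on `A` (orbit map of `n` composed with `ψ`).
[cite: DeSmitRubinSchoof1997, Prop. 2.1 (case n = 1)] -/
def orbitDual (ψ : N →ₗ[B] B) (n : N) : Module.Dual B A :=
  ψ.comp ((LinearMap.toSpanSingleton A N n).restrictScalars B)

/-- Unfolding: `orbitDual ψ n a = ψ (a • n)`. [cite: DeSmitRubinSchoof1997, Prop. 2.1 (case n = 1)] -/
@[simp]
theorem orbitDual_apply (ψ : N →ₗ[B] B) (n : N) (a : A) : orbitDual ψ n a = ψ (a • n) := rfl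

/-- **The `A`-linear lift of a `B`-linear functional**: for `ψ : N →ₗ[B] B`, `tailFormLift pb ψ : N →ₗ[A] A`
sends `n` to the unique `y ∈ A` with `λ(y a) = ψ(a • n)` for all `a`. [cite: DeSmitRubinSchoof1997, Prop. 2.1 (case n = 1)] -/
def tailFormLift (ψ : N →ₗ[B] B) : N →ₗ[A] A where
  toFun n := (tailPairingEquiv pb).symm (orbitDual ψ n)
  map_add' n n' := by
    rw [← map_add]; congr 1; ext a; simp [smul_add]
  map_smul' c n := by
    apply (tailPairingEquiv pb).injective
    rw [LinearEquiv.apply_symm_apply, RingHom.id_apply, smul_eq_mul]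
    ext a
    rw [tailPairingEquiv_apply, tailPairing_mul_left, ← tailPairingEquiv_apply, LinearEquiv.apply_symm_apply,
      orbitDual_apply, orbitDual_apply, mul_smul, smul_comm a c n]

/-- Defining property of the lift: `λ(tailFormLift pb ψ n * a) = ψ(a • n)`. [cite: DeSmitRubinSchoof1997, Prop. 2.1 (case n = 1)] -/
theorem tailForm_tailFormLift_mul (ψ : N →ₗ[B] B) (n : N) (a : A) :
    tailForm pb (tailFormLift pb ψ n * a) = ψ (a • n) := by
  rw [← tailPairing_apply_apply, ← tailPairingEquiv_apply]
  change tailPairingEquiv pb ((tailPairingEquiv pb).symm (orbitDual ψ n)) a = _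
  rw [LinearEquiv.apply_symm_apply, orbitDual_apply]

/-- `λ ∘ (tailFormLift pb ψ) = ψ`. [cite: DeSmitRubinSchoof1997, Prop. 2.1 (case n = 1)] -/
theorem tailFormComp_tailFormLift (ψ : N →ₗ[B] B) : tailFormComp pb (tailFormLift pb ψ) = ψ := by
  ext n
  rw [tailFormComp_apply, ← mul_one (tailFormLift pb ψ n), tailForm_tailFormLift_mul, one_smul]

/-- **Frobenius reciprocity for a monogenic algebra**: for every `A`-module `N`, post-composition with the
tail form is a bijection `Hom_A(N, A) ≃ Hom_B(N, B)`; equivalently (`N = A`) `Hom_B(A, B) = A · λ` is free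
of rank one, and in general the `B`-dual of an `A`-module is its `A`-dual ("the kernel of `λ` contains no
non-zero `A`-submodule"). This is the property by which `S_𝔭`-valued and `ℤ_p`-valued dualities are identified
in Howard 2004, §2.1 (`Hom_{S_𝔭}(N, 𝒟_𝔭(1)) ≅ Hom_{ℤ_p}(N, μ_{p^∞})`). [cite: DeSmitRubinSchoof1997, Prop. 2.1 (case n = 1)] -/
theorem tailFormComp_bijective : Function.Bijective (tailFormComp pb (N := N)) :=
  ⟨tailFormComp_injective pb, fun ψ => ⟨tailFormLift pb ψ, tailFormComp_tailFormLift pb ψ⟩⟩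

/-- The reciprocity bijection as a `B`-linear equivalence `Hom_A(N, A) ≃ₗ[B] Hom_B(N, B)`.
[cite: DeSmitRubinSchoof1997, Prop. 2.1 (case n = 1)] -/
def tailFormCompEquiv : (N →ₗ[A] A) ≃ₗ[B] (N →ₗ[B] B) :=
  LinearEquiv.ofBijective (tailFormComp pb) (tailFormComp_bijective pb)

/-- Unfolding: `tailFormCompEquiv pb φ = λ ∘ φ`. [cite: DeSmitRubinSchoof1997, Prop. 2.1 (case n = 1)] -/
@[simp]
theorem tailFormCompEquiv_apply (φ : N →ₗ[A] A) (n : N) : tailFormCompEquiv pb φ n = tailForm pb (φ n) := rfl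

/-- The inverse of the reciprocity bijection is the lift. [cite: DeSmitRubinSchoof1997, Prop. 2.1 (case n = 1)] -/
theorem tailFormCompEquiv_symm_apply (ψ : N →ₗ[B] B) : (tailFormCompEquiv pb).symm ψ = tailFormLift pb ψ :=
  (tailFormCompEquiv pb).injective (by
    rw [LinearEquiv.apply_symm_apply]; exact (tailFormComp_tailFormLift pb ψ).symm)

end Reciprocity

end Literature.RingTheory.CompleteIntersection
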